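import Summits.BirchSwinnertonDyer.Rank1Residual.Additive.UnramifiedKummerDisjoint
import Literature.NumberTheory.EllipticCurves.LocalKummerMap
import Literature.NumberTheory.EllipticCurves.LocalEulerCharacteristicTorsion
import Literature.NumberTheory.EllipticCurves.CongruenceVisibilityLocalFactors
import HarnessLib

/-!
# Unramified classes versus the local Kummer condition at a finite place `v ∤ p`:
# `#H¹_ur(K_v, E[p]) = #𝓚_v`, and a rational point with no inertia-fixed `p`-th root gives an
# unramified class OUTSIDE `𝓚_v` (cell `b2b-bsdres`, team n1011, seat p16 GEN 4; FILE 5 K-GENERAL of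
# the budget programme T-E3g-BUD0 / BUDn (n1011-p10), r2 ROUTE-2 §II.17.3 D-n.3; skeleton
# `cells/n1011/skel/T-BUD5-K.md`)

HONEST FRAMING (cell `b2b-bsdres`, run/shared/lean/b2b/bsd-rank1-residual/, verbatim in every
file): the goal of the cell is to DELETE the COMBINATION-SHAPED residual classes of the
Birch–Swinnerton-Dyer formula for ALL analytic-rank `≤ 1` elliptic curves over `ℚ` — "full BSD
formula for every rank `≤ 1` curve in class `C`" assembled STRICTLY from published theorems — so
that the rank-`≤ 1` remainder becomes exactly the CONSTRUCTION-SHAPED classes, which are TYPED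
(missing-input `Prop`s), NOT attempted. This is not "finishing BSD". Team n1011 (N10 / N11, the
Route-G budget node): research route; no claim beyond the stated classes; nothing is booked; marks
UNCHANGED. Theorems only: no definition, no named fact, no `sorry`.

## What and why

n1011-p10's assembly `Additive/BudgetFromRationalClasses.lean` (p264381) feeds the Route-G budget
`BudgetLeLambdaAt p W b` from `p^b` classes of `H¹(K, E[p])` that are Kummer away from a finite set
`T` of "Tamagawa places" and Kummer-OR-UNRAMIFIED at `T`; the count needs, at every `v ∈ T`, ONE
unramified class of `H¹(K_v, E[p])` OUTSIDE the local Kummer condition `𝓚_v` (his FILE 4 binder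
`∀ v ∈ T, p ∉ v ∧ ∃ u ∈ H¹_ur(K_v, E[p]), u ∉ 𝓚_v`). This file supplies the REDUCTION-TYPE-FREE
part of that witness over ANY number field `K` (so over every layer `K_n` of a `ℤ_p`-tower as well):

* (the generic count `#H¹_ur(F, W) = #W^{Γ_F}` for EVERY finite discrete `Γ_F`-module — without the
  trivial-inertia hypothesis of `GaloisImage.natCard_unramifiedSubgroup_eq_natCard_invariants` — is
  n1011-p06's `Additive.natCard_unramifiedSubgroup_eq_natCard_invariants_general`
  (`Additive/UnramifiedKummerDisjoint.lean`, row T-E3g-ADD), consumed BY NAME; this file and that one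
  are the two disjoint suppliers of the witness — additive places there, multiplicative places here.)
* §1 `localKummerClass_mem_unramifiedSubgroup_iff` — for `W/K` elliptic, `F ⊇ K` a field
  (`F = K_v`), `n ≠ 0`, `Q ∈ E(F̄)` with `nQ` rational: the local Kummer class `κ_F(Q) = [σ ↦ σQ − Q]`
  is UNRAMIFIED iff `Q` is fixed by the inertia group `I_F` up to an `n`-torsion point, i.e. iff
  some `n`-th root of `nQ` is inertia-fixed (the proof of the tree's `localKummerClass_eq_zero_iff`
  with `Γ_F` replaced by `I_F`).
* §2 `natCard_unramifiedSubgroup_eq_natCard_kummerLocalConditionAt` — at a finite place `v ∤ p` of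
  a number field: `#H¹_ur(K_v, E[p]) = #E(K_v)[p] = #𝓚_v` (p06's general count + `natCard_invariants_torsion_restrictField`
  + `natCard_kummerLocalConditionAt_adicCompletion` + `#(𝓞_v/p) = 1`); and the WITNESS
  `exists_mem_unramifiedSubgroup_not_mem_kummerLocalConditionAt_of_forall_root`: if some
  `P ∈ E(K_v)` has NO inertia-fixed `p`-th root in `E(K̄_v)`, then `κ_v(P) ∈ 𝓚_v ∖ H¹_ur`, hence —
  two finite subgroups of the same order — **`∃ u ∈ H¹_ur(K_v, E[p])` with `u ∉ 𝓚_v`**, in p10's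
  spelling.

The ARITHMETIC input — at a split multiplicative `v ∤ p` with `p ∣ c_v` a generator of the component
group `E(K_v)/E₀(K_v) ≅ ℤ/c_v` has no inertia-fixed `p`-th root (Greenberg LNM 1716 p. 74:
`|ker r_v| = c_v^{(p)}`) — is NOT in this file (skeleton step 4, filed separately).

References: K. Rubin, *Euler systems and Kolyvagin systems*, PCMI 18 (2011) Prop. 1.4.13;
J. S. Milne, *Arithmetic Duality Theorems* (2006) I Lemma 2.9, Lemma 3.3; J. H. Silverman, *AEC*
VIII §2, X §4; R. Greenberg, LNM 1716 (1999) pp. 74, 136 (Cor. 5.6).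
-/

noncomputable section

open scoped Classical NumberField

universe u

/-! ## §1 A local Kummer class is unramified iff some root is fixed by inertia -/

namespace WeierstrassCurve

open Literature.NumberTheory.EllipticCurves Literature.NumberTheory.GaloisRepresentations Field
open Literature.NumberTheory.GaloisRepresentations.IsNonarchimedeanLocalField
open NumberField IsDedekindDomain
open scoped ContRepresentation

section LocalKummerUnramified

variable {K : Type u} [Field K] [CharZero K] (W : WeierstrassCurve K) [W.IsElliptic] {n : ℤ} (hn : n ≠ 0)
variable {E : Type u} [Field E] [Algebra K E] [ValuativeRel E] [TopologicalSpace E]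
  [IsNonarchimedeanLocalField E]

/-- **The local Kummer class `κ_E(Q) = [σ ↦ σQ − Q]` is UNRAMIFIED iff `Q` is fixed by the inertia
group `I_E` up to an `n`-torsion point** — i.e. iff some `n`-th root `Q − T` of `nQ` is inertia-fixed.
(The tree's `localKummerClass_eq_zero_iff` with `Γ_E` replaced by `I_E`, through x11b's
`LocBridge.mem_unramifiedSubgroup_one_iff_exists`: `[φ] ∈ H¹_ur ⟺ φ` is principal on `I_E`.)
Silverman, *AEC*, VIII §2 (the Kummer pairing: `κ(P)` unramified at `v` iff `K_v([n]⁻¹P)/K_v` is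
unramified); Milne, *ADT*, I §2. [cite: SilvermanAEC2009, VIII §2 (Prop. VIII.2.1 and its proof)]
[cite: MilneADT2006, Ch. I §2 (unramified cohomology)] -/
theorem localKummerClass_mem_unramifiedSubgroup_iff (Q : localPoints W E)
    (hQ : n • Q ∈ MulAction.fixedPoints (absoluteGaloisGroup E) (localPoints W E)) :
    W.localKummerClass n hn Q hQ ∈ DiscreteGaloisModule.unramifiedSubgroup
        (GaloisRep.restrictField E (W.torsionGaloisModule n)) 1 ↔
      ∃ T ∈ AddSubgroup.torsionBy (localPoints W E) n,
        ∀ τ ∈ absInertia E, τ • (Q - T) = Q - T := by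
  rw [localKummerClass]
  refine (Summit.BirchSwinnertonDyer.Rank1Residual.X11b.LocBridge.mem_unramifiedSubgroup_one_iff_exists
    _ (W.localKummerCocycle n hn Q hQ)).trans ?_
  constructor
  · rintro ⟨v, hv⟩
    refine ⟨pointsMap W E (v : geomTorsion W n), ?_, fun τ hτ => ?_⟩
    · change n • pointsMap W E ((v : geomTorsion W n) : geomPoints W) = 0
      rw [← map_zsmul, (mem_geomTorsion_iff W n _).mp v.2, map_zero]
    · have h2 := W.pointsMap_localKummerCocycle_apply n hn Q hQ τ
      rw [hv τ hτ] at h2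
      have h3 : pointsMap W E (((absGaloisRestrict K E τ • v : geomTorsion W n) : geomPoints W) -
          v) = τ • Q - Q := h2
      rw [map_sub, Literature.NumberTheory.EllipticCurves.AddSubgroup.torsionBy.coe_smul,
        ← resGal_eq_absGaloisRestrict, pointsMap_smul] at h3
      rw [smul_sub, sub_eq_sub_iff_sub_eq_sub, h3]
  · rintro ⟨T, hT, hfix⟩
    refine ⟨(W.torsionPointsEquiv n (E := E) hn).symm ⟨T, hT⟩, fun τ hτ => ?_⟩
    apply (W.torsionPointsEquiv n (E := E) hn).injective
    apply Subtype.ext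
    change pointsMap W E ((W.localKummerCocycle n hn Q hQ).1 τ : geomTorsion W n) =
      pointsMap W E (((absGaloisRestrict K E τ •
        (W.torsionPointsEquiv n (E := E) hn).symm ⟨T, hT⟩ : geomTorsion W n) : geomPoints W) -
          (W.torsionPointsEquiv n (E := E) hn).symm ⟨T, hT⟩)
    rw [pointsMap_localKummerCocycle_apply, map_sub,
      Literature.NumberTheory.EllipticCurves.AddSubgroup.torsionBy.coe_smul,
      ← resGal_eq_absGaloisRestrict, pointsMap_smul, pointsMap_torsionPointsEquiv_symm]
    have h := hfix τ hτ
    rw [smul_sub, sub_eq_sub_iff_sub_eq_sub] at h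
    exact h

/-- **A rational point's Kummer class is unramified iff the point has an inertia-fixed `n`-th root.**
For `P ∈ (W⁄E)(E)` (read in `E(Ē)` through `e = baseChangeGeomPointsEquiv`):
`localKummerMap P ∈ H¹_ur(E, E[n]) ⟺ ∃ Q ∈ E(Ē)` with `nQ = e(P)` fixed by every `τ ∈ I_E`.
[cite: SilvermanAEC2009, VIII §2 (Prop. VIII.2.1 and its proof)] -/
theorem localKummerMap_mem_unramifiedSubgroup_iff (P : (W.baseChange E).toAffine.Point) :
    W.localKummerMap E hn P ∈ DiscreteGaloisModule.unramifiedSubgroup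
        (GaloisRep.restrictField E (W.torsionGaloisModule n)) 1 ↔
      ∃ Q : localPoints W E,
        n • Q = W.baseChangeGeomPointsEquiv E (toGeomPoints (W.baseChange E) P) ∧
          ∀ τ ∈ absInertia E, τ • Q = Q := by
  rw [W.localKummerMap_eq_localKummerClass E hn P (W.localZSMulRoot E hn P)
    (W.zsmul_mem_fixedPoints_of_eq E (W.zsmul_localZSMulRoot E hn P)) (W.zsmul_localZSMulRoot E hn P),
    W.localKummerClass_mem_unramifiedSubgroup_iff hn]
  constructor
  · rintro ⟨T, hT, hfix⟩
    refine ⟨W.localZSMulRoot E hn P - T, ?_, hfix⟩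
    have hT0 : n • T = 0 := hT
    rw [zsmul_sub, hT0, sub_zero, zsmul_localZSMulRoot]
  · rintro ⟨Q, hQn, hfix⟩
    refine ⟨W.localZSMulRoot E hn P - Q, ?_, fun τ hτ => ?_⟩
    · change n • (W.localZSMulRoot E hn P - Q) = 0
      rw [zsmul_sub, zsmul_localZSMulRoot, hQn, sub_self]
    · rw [sub_sub_cancel]
      exact hfix τ hτ

end LocalKummerUnramified

/-! ## §2 At a finite place `v ∤ p` of a number field: `#H¹_ur(K_v, E[p]) = #𝓚_v`, and the witness -/

section NumberField

variable {K : Type} [Field K] [NumberField K] (W : WeierstrassCurve K) [W.IsElliptic]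
  (v : HeightOneSpectrum (𝓞 K)) {p : ℕ} [hp : Fact p.Prime]

/-- **`#H¹_ur(K_v, E[p]) = #E(K_v)[p]`** at every finite place `v` (any reduction type, any residue
characteristic): p06's general unramified count + `#(E[p]|_{Γ_{K_v}})^{Γ_{K_v}} = #E(K_v)[p]`
(`natCard_invariants_torsion_restrictField`). Milne, *ADT*, I Lemma 2.9 + Lemma 3.3 (`H⁰(K_v, E_p) = E(K_v)_p`).
[cite: MilneADT2006, Ch. I, Lemma 2.9 and Lemma 3.3] -/
theorem natCard_unramifiedSubgroup_torsion_eq_natCard_ker_nsmul :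
    Nat.card (DiscreteGaloisModule.unramifiedSubgroup
        ((W.torsionGaloisModule (p : ℤ)).restrictField (v.adicCompletion K)) 1) =
      Nat.card (nsmulAddMonoidHom p : (W.baseChange (v.adicCompletion K)).toAffine.Point →+ _).ker := by
  haveI : CharZero (v.adicCompletion K) := charZero_adicCompletion v
  haveI : NeZero p := ⟨hp.out.ne_zero⟩
  haveI : Finite (geomTorsion W (p : ℤ)) := finite_geomTorsion_of_neZero W p
  rw [Summit.BirchSwinnertonDyer.Rank1Residual.Additive.natCard_unramifiedSubgroup_eq_natCard_invariants_general,
    natCard_invariants_torsion_restrictField W (v.adicCompletion K) hp.out.ne_zero]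

/-- **`#H¹_ur(K_v, E[p]) = #𝓚_v` at a finite place `v ∤ p`**: both equal `#E(K_v)[p]` — the
unramified count (previous lemma) and the local Kummer sequence `#𝓚_v = #E(K_v)[p] · #(𝓞_v/p)`
(`natCard_kummerLocalConditionAt_adicCompletion`) with `#(𝓞_v/p) = 1` for `v ∤ p`
(`natCard_quot_adicCompletionIntegers_eq_one`). Greenberg, LNM 1716 p. 74 (at `v ∤ p` the images
of the local Kummer maps and the unramified classes have the same order `#E(K_v)_p`); Milne *ADT*
I Lemma 3.3. [cite: MilneADT2006, Ch. I, Lemma 2.9 and Lemma 3.3] -/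
theorem natCard_unramifiedSubgroup_eq_natCard_kummerLocalConditionAt
    (hpv : (p : 𝓞 K) ∉ v.asIdeal) :
    Nat.card (DiscreteGaloisModule.unramifiedSubgroup
        ((W.torsionGaloisModule (p : ℤ)).restrictField (v.adicCompletion K)) 1) =
      Nat.card (W.kummerLocalConditionAt (p : ℤ) (v.adicCompletion K)) := by
  rw [W.natCard_unramifiedSubgroup_torsion_eq_natCard_ker_nsmul v,
    W.natCard_kummerLocalConditionAt_adicCompletion v hp.out.ne_zero,
    natCard_quot_adicCompletionIntegers_eq_one hpv, mul_one]

/-- **The witness, from a rational point with NO inertia-fixed `p`-th root.** At a finite place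
`v ∤ p` of a number field `K`, if some `P ∈ E(K_v)` is such that EVERY `Q ∈ E(K̄_v)` with `pQ = P`
is moved by some element of the inertia group `I_{K_v}`, then there is an UNRAMIFIED class of
`H¹(K_v, E[p])` OUTSIDE the local Kummer condition `𝓚_v` — the per-place input of n1011-p10's
budget assembly (T-E3g-BUD0 FILE 4 / BUDn), in his spelling. Proof: `κ_v(P) ∈ 𝓚_v`
(`localKummerMap_mem`) is ramified (§1), and `H¹_ur`, `𝓚_v` are finite of the same order (previous
lemma), so `H¹_ur ⊄ 𝓚_v`. (The arithmetic supply of such `P` — a generator of the component group at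
a split multiplicative `v` with `p ∣ c_v` — is a separate lemma; Greenberg LNM 1716 p. 74,
`|ker r_v| = c_v^{(p)}`, and Cor. 5.6.) [cite: GreenbergLNM1716, §3 p. 74 and Cor. 5.6 (proof)]
[cite: MilneADT2006, Ch. I, Lemma 2.9 and Lemma 3.3] -/
theorem exists_mem_unramifiedSubgroup_not_mem_kummerLocalConditionAt_of_forall_root
    (hpv : (p : 𝓞 K) ∉ v.asIdeal) (P : (W.baseChange (v.adicCompletion K)).toAffine.Point)
    (hP : ∀ Q : localPoints W (v.adicCompletion K),
      (p : ℤ) • Q = W.baseChangeGeomPointsEquiv (v.adicCompletion K)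
          (toGeomPoints (W.baseChange (v.adicCompletion K)) P) →
        ∃ τ ∈ absInertia (v.adicCompletion K), τ • Q ≠ Q) :
    ∃ u ∈ DiscreteGaloisModule.unramifiedSubgroup
        ((W.torsionGaloisModule (p : ℤ)).restrictField (v.adicCompletion K)) 1,
      u ∉ W.kummerLocalConditionAt (p : ℤ) (v.adicCompletion K) := by
  have hp0 : (p : ℤ) ≠ 0 := by exact_mod_cast hp.out.ne_zero
  set U := DiscreteGaloisModule.unramifiedSubgroup
    ((W.torsionGaloisModule (p : ℤ)).restrictField (v.adicCompletion K)) 1 with hU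
  set L := W.kummerLocalConditionAt (p : ℤ) (v.adicCompletion K) with hL
  -- the Kummer class of `P`: inside `𝓚_v`, outside `H¹_ur`
  have hκL : W.localKummerMap (v.adicCompletion K) hp0 P ∈ L := W.localKummerMap_mem _ hp0 P
  have hκU : W.localKummerMap (v.adicCompletion K) hp0 P ∉ U := by
    rw [hU, W.localKummerMap_mem_unramifiedSubgroup_iff hp0]
    rintro ⟨Q, hQn, hfix⟩
    obtain ⟨τ, hτ, hne⟩ := hP Q hQn
    exact hne (hfix τ hτ)
  -- equal finite orders
  haveI : Finite L := W.finite_kummerLocalConditionAt_adicCompletion v hp.out.ne_zero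
  have hcard : Nat.card U = Nat.card L :=
    W.natCard_unramifiedSubgroup_eq_natCard_kummerLocalConditionAt v hpv
  by_contra h
  have hle : U ≤ L := fun u hu => by
    by_contra hu'
    exact h ⟨u, hu, hu'⟩
  have heq : U = L := AddSubgroup.eq_of_le_of_card_ge hle (le_of_eq hcard.symm)
  exact hκU (heq ▸ hκL)

end NumberField

end WeierstrassCurve

end
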